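import Summits.AtomisticToContinuum.Crystallization.Theorems.ChartedZeroExcessLayeredLatticeLiouvilleZAA

/-!
# Part ZA «MetricEnclosure» (lens-2 g75) — part 2 of 2 (sequel of `…ChartedZeroExcessLayeredLatticeLiouvilleZAA`)

Split for the 400-line cap by the landing lane (hand-2 g36); the module docstring of part 1 (`…ChartedZeroExcessLayeredLatticeLiouvilleZAA`) describes the whole node.  Same namespace; all FQNs unchanged.
0 sorry; standard axioms.
-/

noncomputable section
open scoped BigOperators Classical InnerProductSpace RealInnerProductSpace
open MeasureTheory Set Metric Filter Topology
open Summit.AtomisticToContinuum.Crystallization.Theorems.ChartedPlanarOrderRigidityDoor (E3 IsClean)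
open Summit.AtomisticToContinuum.Crystallization.Theorems.ChartedPlanarOrderDensityDichotomy (μS IsSep)
open Summit.AtomisticToContinuum.Crystallization.Theorems.ChartedPlanarOrderCleanScaleP (IsCleanP IsDoorSetP isCleanP_one_iff isCleanP_mono)
open Summit.AtomisticToContinuum.Crystallization.Theorems.ChartedPlanarOrderMesoCut (LayeredHom EnvClose)
open Summit.AtomisticToContinuum.Crystallization.Theorems.ChartedPlanarOrderDoorLayeredOsc (IsTwoShellAffineGood)
open Literature.MathematicalPhysics.StatisticalMechanics (lennardJones)

namespace Summit.AtomisticToContinuum.Crystallization.Theorems.ChartedZeroExcessLayeredLatticeLiouville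

/-! ### ZA-4  The two pieces (EN) / (OC) (typed; binders of (QE) verbatim; every constant symbolic) -/

section Pieces

/-- ★★★ **(EN) «EnclosureNetP ϑc ϑp r q rsh rm σ ϑr Rs ε rI ℓ ε₁ ζ κ κ₂ Dm aHi Λ θ s» — EVERY AXIS THROUGH EVERY INNER-CORE ATOM CARRIES A DATUM**
(the EXHAUSTION of the rigid/soft dichotomy; ORDER + DENSITY, purely metric — no star, no frame).  Under the binders of (QE) verbatim and for every cool
shadow crystal `C = placedCrystal L′ w′ U t` of the shell (74D's (SC) output, as a HYPOTHESIS): every atom `x ∈ coreOf S K r` (the loose ball with its rim;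
the cool part of the core is REG-out's) has a site `c ∈ C` such that for every unit vector `u` EITHER (soft) a site `c′ ∈ C` in the `κ`-cone of `u`
(`κ‖c′ − c‖ ≤ ⟪c′ − c, u⟫`) is reached by a net chain `IsNetChain (3ϑp + ε₁) ζ ε₁ S C x c c′` (≤ three centre readings, or a centre and a pair reading;
mismatch `ε₁`, collinearity defect `ζ`, `ε₁`-registered end), OR (rigid) a site `c′ ∈ C` in the `κ`-cone of `−u` with `Dm ≤ dist c c′` is read against `x`
by ONE star — an atom `p ∈ S` with `|dist x p − dist c c′| ≤ 2ϑp + ε₁`, `dist p c′ ≤ ε₁` — AND a soft chain exists in the WIDE `κ₂`-cone of `u`.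
MECHANISM (why it should hold): ANCHORS — members of `ϑc`-cool stars (every atom within `4` of an atom of the cool zone) are `ε₁`-registered to `C` by
the rigid datum with `ϑc` and REG-out co-members (`(2ϑc + 2ε)/κ ≲ 6·10⁻⁴ ≤ ε₁ = 10⁻³` at the column's `∃ϑm ≤ 10⁻⁴`), so for the fat container
`K = S ∩ B̄(x₀, 4)` anchors start at radius `R_a ∈ [7.8, 8.8]` (probe); HOPS — a `ϑp`-tame star reads `|dist x x₁ − model| ≤ ϑp` for members (ZA-1), hop
`≤ 3.8`, pair readings `≤ 6.6` (midpoint atom: lens radius `≥ 0.7 ≥` covering radius); ROWS — in-plane rows are dense in every stacking, steep EQUAL-hop rows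
need the letters at the hop layers in arithmetic progression mod 3 (absent in long-period words: probe word `ABCACB` leaves `62/150` axes at the centre),
but a centre hop `≤ 3.8` followed by ONE pair-read hop `≤ 6.6` with the intermediate site tuned in its layer coset has defect `≤ ζ = 10⁻²` in EVERY word;
ENCLOSURE — `K ⊆ B̄(x₀, 4)` ⇒ behind-depth `+` front-depth `≤ 2R_a`: soft reach `≤ 10.4–11.4` behind, else rigid reach `≤ 6.6` in front.  PROBE
(`dev/enclosure_probe3.py`, pure geometry: anchors := cool members, fcc/hcp/dhcp/`ABCACB`/`ABCBACBCABAC`/twin `ABABABCBCBCB`, scale `1`/`0.97`, tilts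
`0°–55°`, `κ ∈ {0.8, 0.9}`, hop `3.8`, `ζ ∈ {0.005, 0.01}`): `150/150` axes covered on every sampled core atom (`334` rows).
INCOMPARABLE with (CM) formally (⇏: no assignment/injectivity/occupancy; ⇍: anchors `ε₁ ≪ d`, local slops `ϑp`); WEAKER IN KIND — local order and density,
the quantitative `d` being the junction's.  UNDECIDED→TRUE-leaning · INSTRUMENTABLE «Enclosure-T» (census ⑦ = the probe run on the census cores with the
registrable atoms as anchors; PASS iff every axis of every inner-core atom is covered at `(ε₁, ζ, κ, κ₂, Dm) = (10⁻³, 10⁻², 4/5, 1/2, 2)`) · ATTACKABLE-M.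
Why it might fail: (a) COHERENT LABELLING — the chain sites must be `x`'s own sheet/letter continued inward from the registered annuli; a `ϑp`-tame twin
lamella through the ball is read consistently by stars but not by `C` (excluded only because its bounding partial must pierce the enclosure: order, not
estimate); (b) hop membership — a chain atom `3.8` model-units away must lie in the star (`≤ 4`): relative displacement `≤ 0.2` is a LOCAL tameness fact but
must be organised inward; (c) anchor registration needs `ϑc ≲ 2·10⁻⁴` (the column's `∃ϑm` allows it; at `ϑc ≥ 10⁻³` the piece is false as pinned).
Sources: parts UC (`IsTameStar`), YZ ((SC)/(CM)), YX ((XR♮) (M)); F. John 1961 (`sup` vs `L²` rotation control); FJM 2002 §4; Hirth–Lothe ch. 10; GPS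
dilution-of-precision folklore (`1/κ`); CRITIC-LEDGER row 1322. [this file, g75] -/
def EnclosureNetP (ϑc ϑp r q rsh rm σ ϑr Rs ε rI ℓ ε₁ ζ κ κ₂ Dm aHi Λ θ s : ℝ) : Prop :=
  ∀ δ : ℝ, 0 < δ → ∀ a : ℝ, 0 < a →
    ∀ S : Set E3, IsDoorSetP aHi δ S → (∀ z : E3, Summable fun y : S => lennardJones (dist z (y : E3))) →
      (∀ p ∈ S, IsTwoShellAffineGood θ S p) →
        ∀ (L : E3 ≃L[ℝ] E3) (w : ℤ → E3), IsEquilChart a s Λ L w →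
          ∀ (x₀ : E3) (K : Set E3), K ⊆ S → (∀ k ∈ K, dist k x₀ ≤ q) →
            IsTameOn ϑp S (LayeredHom (L : E3 →L[ℝ] E3) w) (coreOf S K rm) →
              IsTameOn ϑc S (LayeredHom (L : E3 →L[ℝ] E3) w) (moatIn S K r (r + rsh)) →
                ∀ (L' : E3 →L[ℝ] E3) (w' : ℤ → E3) (U : E3 ≃ₗᵢ[ℝ] E3) (t : E3),
                  IsCoolShadowCrystal σ ϑr Rs ε r rI ℓ S K (LayeredHom (L : E3 →L[ℝ] E3) w) L' w' U t →
                    ∀ x ∈ coreOf S K r, ∃ c ∈ placedCrystal L' w' U t, ∀ u : E3, ‖u‖ = 1 →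
                      (∃ c' ∈ placedCrystal L' w' U t, κ * ‖c' - c‖ ≤ ⟪c' - c, u⟫_ℝ ∧
                          IsNetChain (3 * ϑp + ε₁) ζ ε₁ S (placedCrystal L' w' U t) x c c') ∨
                      ((∃ c' ∈ placedCrystal L' w' U t, κ * ‖c' - c‖ ≤ ⟪c' - c, -u⟫_ℝ ∧ Dm ≤ dist c c' ∧
                          ∃ p ∈ S, |dist x p - dist c c'| ≤ 2 * ϑp + ε₁ ∧ dist p c' ≤ ε₁) ∧
                        ∃ c' ∈ placedCrystal L' w' U t, κ₂ * ‖c' - c‖ ≤ ⟪c' - c, u⟫_ℝ ∧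
                          IsNetChain (3 * ϑp + ε₁) ζ ε₁ S (placedCrystal L' w' U t) x c c')

/-- ★★★ **(OC) «CoreOccupancyP ϑc ϑp r q rsh rm σ ϑr Rs ε rI ℓ d₁ aHi Λ θ s» — NO VACANT SITE IN THE DEEP ZONE** (the COUNTING clause).  Under the
binders of (QE) verbatim, for every cool shadow crystal `C` of the shell: every site `c ∈ C` within `rI` of `K` has an atom `p ∈ S` with `dist p c ≤ d₁`
(REG-in covers the sites beyond `rI`).  STRICTLY WEAKER than (CM) (PROVED `coreOccupancyP_of_mildCoreFilling`: `d ≤ d₁`, `rI ≤ ρf`).  MECHANISM: clean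
two-shell completeness (`IsCleanP`: every atom carries a full `12 + 6` pattern at scale `∈ [9/10, 1]`) propagated inward from the REG-in zone along
`C`-rows — an occupied site's atom has a neighbour near each adjacent site; no drift accumulates because each step re-anchors on `C`.  TRUE-leaning ·
ATTACKABLE-S · INSTRUMENTABLE (census ⑦: vacancy count of the fitted crystal inside `rI = 10` at tolerance `d₁ = 2/5`; PASS iff `0`).
Why it might fail: the clean pattern around an atom is oriented by the atom's OWN frame, which tameness controls only hop by hop (the frame obstruction):
the inward induction must re-anchor on `C` at every step (site ↦ nearest atom, tolerance `d₁ = 2/5` against a true drift `≈ 1/4` and separation `27/32`),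
and a differently stacked lamella inside the ball that is clean and `ϑp`-tame in its own right (the twin lamella of (EN) (a)) would leave the `C`-sites
it covers unserved — excluded only because its bounding partials must pierce the registered enclosure (order, not estimate).
Sources: part UC/CleanScaleP (`IsCleanP`, `isSep_of_isClean`); Conway–Sloane SPLAG ch. 7 (second-shell patterns of close packings); parts YX/YZ (REG-in,
occupancy clause of (CM)); CRITIC-LEDGER row 1322. [this file, g75] -/
def CoreOccupancyP (ϑc ϑp r q rsh rm σ ϑr Rs ε rI ℓ d₁ aHi Λ θ s : ℝ) : Prop :=
  ∀ δ : ℝ, 0 < δ → ∀ a : ℝ, 0 < a →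
    ∀ S : Set E3, IsDoorSetP aHi δ S → (∀ z : E3, Summable fun y : S => lennardJones (dist z (y : E3))) →
      (∀ p ∈ S, IsTwoShellAffineGood θ S p) →
        ∀ (L : E3 ≃L[ℝ] E3) (w : ℤ → E3), IsEquilChart a s Λ L w →
          ∀ (x₀ : E3) (K : Set E3), K ⊆ S → (∀ k ∈ K, dist k x₀ ≤ q) →
            IsTameOn ϑp S (LayeredHom (L : E3 →L[ℝ] E3) w) (coreOf S K rm) →
              IsTameOn ϑc S (LayeredHom (L : E3 →L[ℝ] E3) w) (moatIn S K r (r + rsh)) →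
                ∀ (L' : E3 →L[ℝ] E3) (w' : ℤ → E3) (U : E3 ≃ₗᵢ[ℝ] E3) (t : E3),
                  IsCoolShadowCrystal σ ϑr Rs ε r rI ℓ S K (LayeredHom (L : E3 →L[ℝ] E3) w) L' w' U t →
                    ∀ c ∈ placedCrystal L' w' U t, (∃ k ∈ K, dist c k ≤ rI) → ∃ p ∈ S, dist p c ≤ d₁

/-- (OC) is WEAKER for a larger tolerance. [this file, g75] -/
theorem CoreOccupancyP.of_le {ϑc ϑp r q rsh rm σ ϑr Rs ε rI ℓ d₁ d₁' aHi Λ θ s : ℝ} (h : d₁ ≤ d₁')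
    (hO : CoreOccupancyP ϑc ϑp r q rsh rm σ ϑr Rs ε rI ℓ d₁ aHi Λ θ s) : CoreOccupancyP ϑc ϑp r q rsh rm σ ϑr Rs ε rI ℓ d₁' aHi Λ θ s :=
  fun δ hδ a ha S hS hsum hgood L w hLw x₀ K hKS hKq hmild hcool L' w' U t hC c hc hk => by
    obtain ⟨p, hp, hpc⟩ := hO δ hδ a ha S hS hsum hgood L w hLw x₀ K hKS hKq hmild hcool L' w' U t hC c hc hk
    exact ⟨p, hp, hpc.trans h⟩

/-- ★ **(CM)(d) ⇒ (OC)(d₁) for `d ≤ d₁`, `rI ≤ ρf` (PROVED — the counting piece is STRICTLY WEAKER than the target)**: enumerate the (finite: `δ`-separated,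
`K ⊆ S ∩ B̄(x₀, q)`) core, take (CM)'s filling `y₀`; a site within `rI ≤ ρf` of `K` is some `y₀ i`, and `xf i ∈ S` is within `d ≤ d₁`. [this file, g75] -/
theorem coreOccupancyP_of_mildCoreFilling {ϑc ϑp r q rsh ρ rm σ ϑr Rs ε rI ℓ ρf d d₁ aHi Λ θ s : ℝ} (hd : d ≤ d₁) (hrI : rI ≤ ρf)
    (h : MildCoreFillingP ϑc ϑp r q rsh ρ rm σ ϑr Rs ε rI ℓ ρf d aHi Λ θ s) : CoreOccupancyP ϑc ϑp r q rsh rm σ ϑr Rs ε rI ℓ d₁ aHi Λ θ s := by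
  intro δ hδ a ha S hS hsum hgood L w hLw x₀ K hKS hKq hmild hcool L' w' U t hC c hc hk
  have hKfin : K.Finite :=
    (Literature.Probability.Process.LocalConfig.finite_inter_of_separated hδ hS.2.1 (isCompact_closedBall x₀ q)).subset
      fun k hk => ⟨mem_closedBall.2 (hKq k hk), hKS hk⟩
  obtain ⟨n, f, hf⟩ := (coreOf_finite hδ hS.2.1 hKfin ρ).fin_embedding
  obtain ⟨y₀, -, -, hyd, hfill⟩ := h δ hδ a ha S hS hsum hgood L w hLw x₀ K hKS hKq hmild hcool n f f.injective hf L' w' U t hC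
  obtain ⟨k, hkK, hck⟩ := hk
  obtain ⟨i, hi⟩ := hfill c hc ⟨k, hkK, hck.trans hrI⟩
  have hfi : (f i : E3) ∈ coreOf S K ρ := hf ▸ Set.mem_range_self i
  exact ⟨f i, hfi.1, by rw [← hi]; exact (hyd i).trans hd⟩

end Pieces

/-! ### ZA-5  THE JUNCTION (CM) ⟸ (EN) ∧ (OC) (PROVED) and the re-pinned instances down to the docket leaf -/

section Junction

variable {n : ℕ}

/-- ★★★ **JUNCTION (PROVED): (EN)(ε₁, ζ, κ, κ₂, Dm) ∧ (OC)(d₁) ⇒ (CM)(d)** under the dial arithmetic (`ηA := 3ϑp + 2ε₁ + ζ`, `ηB := 2ϑp + 2ε₁`,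
`D₀` a free coarse radius): `ηA ≤ κd`, `ηA ≤ κ₂D₀`, `D₀ < 2κDm`, `ηB ≤ Dm`, `ηB ≤ κd`, `ηB(2Dm − ηB) ≤ d(2κDm − D₀)`; `ε ≤ d ≤ d₁`, `2d < 27/32` (hard core
of door sets ⇒ injectivity), `d + d₁ < σ` (separation of `C` ⇒ occupancy is by the assigned site), `rI + d₁ ≤ ρ`, `ρf + ε ≤ ρ`, `ρf < ℓ`, `ρ < ℓ`.
`y₀ i :=` the site the enclosure lemma (inner core) or REG-out (cool core) pins `xf i` to. [this file, g75] -/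
theorem mildCoreFillingP_of_enclosureNet_occupancy
    {ϑc ϑp r q rsh ρ rm σ ϑr Rs ε rI ℓ ρf ε₁ ζ κ κ₂ Dm D₀ d d₁ aHi Λ θ s : ℝ}
    (haHi : aHi ≤ 1) (hϑp : 0 ≤ ϑp) (hε₁ : 0 ≤ ε₁) (hζ : 0 ≤ ζ) (hκ₀ : 0 < κ) (hκ₁ : κ ≤ 1) (hκ₂ : 0 < κ₂) (hκ₂₁ : κ₂ ≤ 1)
    (hA : 3 * ϑp + 2 * ε₁ + ζ ≤ κ * d) (hA₂ : 3 * ϑp + 2 * ε₁ + ζ ≤ κ₂ * D₀) (hgap : D₀ < 2 * κ * Dm) (hBη : 2 * ϑp + 2 * ε₁ ≤ Dm)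
    (hBκ : 2 * ϑp + 2 * ε₁ ≤ κ * d) (hB : (2 * ϑp + 2 * ε₁) * (2 * Dm - (2 * ϑp + 2 * ε₁)) ≤ d * (2 * κ * Dm - D₀))
    (hεd : ε ≤ d) (hdd₁ : d ≤ d₁) (hsep : 2 * d < 27 / 32) (hσ : d + d₁ < σ) (hrIρ : rI + d₁ ≤ ρ) (hρf : ρf + ε ≤ ρ) (hρfℓ : ρf < ℓ)
    (hρℓ : ρ < ℓ)
    (hEN : EnclosureNetP ϑc ϑp r q rsh rm σ ϑr Rs ε rI ℓ ε₁ ζ κ κ₂ Dm aHi Λ θ s)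
    (hOC : CoreOccupancyP ϑc ϑp r q rsh rm σ ϑr Rs ε rI ℓ d₁ aHi Λ θ s) :
    MildCoreFillingP ϑc ϑp r q rsh ρ rm σ ϑr Rs ε rI ℓ ρf d aHi Λ θ s := by
  intro δ hδ a ha S hS hsum hgood L w hLw x₀ K hKS hKq hmild hcool n xf hxf hrange L' w' U t hC
  have hCsep : IsSep σ (placedCrystal L' w' U t) := isSep_placedCrystal U t hC.2.1
  have hSsep : IsSep (27 / 32) S := isSep_of_isDoorSetP haHi hS
  have hxcore : ∀ i, xf i ∈ coreOf S K ρ := fun i => hrange ▸ Set.mem_range_self i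
  have hηA : 0 ≤ 3 * ϑp + 2 * ε₁ + ζ := by positivity
  -- Step 1: every core atom is pinned to a site of C within d.
  have key : ∀ i, ∃ c ∈ placedCrystal L' w' U t, dist (xf i) c ≤ d := by
    intro i
    obtain ⟨hxS, k, hk, hxk⟩ := hxcore i
    by_cases hfar : ∀ k ∈ K, r < dist (xf i) k
    · obtain ⟨c, hc, hxc⟩ := hC.2.2.2.1 (xf i) hxS ⟨k, hk, lt_of_le_of_lt hxk hρℓ⟩ hfar
      exact ⟨c, hc, hxc.trans hεd⟩
    · push Not at hfar
      obtain ⟨k', hk', hxk'⟩ := hfar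
      obtain ⟨c, hc, hdata⟩ :=
        hEN δ hδ a ha S hS hsum hgood L w hLw x₀ K hKS hKq hmild hcool L' w' U t hC (xf i) ⟨hxS, k', hk', hxk'⟩
      refine ⟨c, hc, dist_le_of_enclosed (C := placedCrystal L' w' U t) hκ₀ hκ₁ hκ₂ hκ₂₁ hηA hA hA₂ hgap hBη hBκ hB fun u hu => ?_⟩
      rcases hdata u hu with ⟨c', hc', hdir, hchain⟩ | ⟨⟨c', hc', hdir, hDm, p, -, hread, hanc⟩, c'', hc'', hdir'', hchain''⟩
      · refine Or.inl ⟨c', hc', hdir, ?_⟩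
        have := dist_le_of_isNetChain hchain
        linarith
      · refine Or.inr ⟨⟨c', hc', hdir, hDm, ?_⟩, c'', hc'', hdir'', ?_⟩
        · have h1 := (abs_sub_le_iff.1 hread).2
          have h2 : dist (xf i) p ≤ dist (xf i) c' + dist c' p := dist_triangle _ _ _
          rw [dist_comm c' p] at h2
          linarith
        · have := dist_le_of_isNetChain hchain''
          linarith
  choose y₀ hy₀C hy₀d using key
  refine ⟨y₀, ?_, hy₀C, hy₀d, ?_⟩
  · -- Step 2: injectivity from the hard core of S.
    intro i j hij
    apply hxf
    by_contra hne
    have hfar := hSsep (xf i) (hxcore i).1 (xf j) (hxcore j).1 hne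
    have hnear : dist (xf i) (xf j) ≤ d + d := by
      calc dist (xf i) (xf j) ≤ dist (xf i) (y₀ i) + dist (y₀ i) (xf j) := dist_triangle _ _ _
        _ ≤ d + d := add_le_add (hy₀d i) (by rw [hij, dist_comm]; exact hy₀d j)
    linarith
  · -- Step 3: occupancy from (OC) on deep sites and REG-in on the rest.
    intro c hc hcK
    obtain ⟨k, hk, hck⟩ := hcK
    have hatom : ∃ p ∈ S, dist p c ≤ d₁ ∧ ∃ k ∈ K, dist p k ≤ ρ := by
      by_cases hdeep : ∃ k ∈ K, dist c k ≤ rI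
      · obtain ⟨p, hp, hpc⟩ := hOC δ hδ a ha S hS hsum hgood L w hLw x₀ K hKS hKq hmild hcool L' w' U t hC c hc hdeep
        obtain ⟨k₁, hk₁, hck₁⟩ := hdeep
        exact ⟨p, hp, hpc, k₁, hk₁, by linarith [dist_triangle p c k₁]⟩
      · push Not at hdeep
        obtain ⟨p, hp, hpc⟩ := hC.2.2.2.2 c hc ⟨k, hk, lt_of_le_of_lt hck hρfℓ⟩ hdeep
        exact ⟨p, hp, hpc.trans (hεd.trans hdd₁), k, hk, by linarith [dist_triangle p c k]⟩
    obtain ⟨p, hp, hpc, k₁, hk₁, hpk₁⟩ := hatom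
    have hpcore : p ∈ Set.range xf := hrange ▸ ⟨hp, k₁, hk₁, hpk₁⟩
    obtain ⟨i, rfl⟩ := hpcore
    refine ⟨i, ?_⟩
    by_contra hne
    have hfar := hCsep (y₀ i) (hy₀C i) c hc hne
    have hnear : dist (y₀ i) c ≤ d + d₁ := by
      calc dist (y₀ i) c ≤ dist (y₀ i) (xf i) + dist (xf i) c := dist_triangle _ _ _
        _ ≤ d + d₁ := add_le_add (by rw [dist_comm]; exact hy₀d i) hpc
    linarith

/-- ★★ **(CM) AT THE RE-PINNED DIALS FROM (EN) ∧ (OC) (PROVED instance)**: docket geometry `(r, q, rsh, ρ, rm) = (8, 4, 12, 16, 16)`,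
`(aHi, Λ, θ, s) = (1, 2, 1/16, 1/50)`, loose tameness `ϑp = 1/10` (the column's), shadow `(σ, ϑr, Rs, ε) = (17/20, 10⁻⁴, 5, 10⁻⁴)` on the zones
`(8, 43/2)` / `(10, 43/2)`, occupancy radius `ρf = ρ − 2ε`, enclosure dials `(ε₁, ζ, κ, κ₂, Dm) = (10⁻³, 10⁻², 4/5, 1/2, 2)` (coarse radius `D₀ = 2/3`
internal), tolerances `d = d₁ = 2/5`: `ηA = 0.312 ≤ κd = 0.32 ∧ κ₂D₀ = 1/3`; `D₀ < 2κDm = 16/5`; `ηB = 0.202`, `ηB(4 − ηB) = 0.767… ≤ d(16/5 − 2/3) =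
1.013…`; `2d = 4/5 < 27/32`; `d + d₁ = 4/5 < 17/20`.  `ϑc` free (the column's `∃ϑm`). [this file, g75] -/
theorem mildCoreFillingP_instance_of_enclosure {ϑc : ℝ}
    (hEN : EnclosureNetP ϑc (1 / 10) 8 4 12 16 (17 / 20) (1 / 10000) 5 (1 / 10000) 10 (43 / 2) (1 / 1000) (1 / 100) (4 / 5) (1 / 2) 2
      1 2 (1 / 16) (1 / 50))
    (hOC : CoreOccupancyP ϑc (1 / 10) 8 4 12 16 (17 / 20) (1 / 10000) 5 (1 / 10000) 10 (43 / 2) (2 / 5) 1 2 (1 / 16) (1 / 50)) :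
    MildCoreFillingP ϑc (1 / 10) 8 4 12 16 16 (17 / 20) (1 / 10000) 5 (1 / 10000) 10 (43 / 2) (79999 / 5000) (2 / 5) 1 2 (1 / 16) (1 / 50) :=
  mildCoreFillingP_of_enclosureNet_occupancy (D₀ := 2 / 3) le_rfl (by norm_num) (by norm_num) (by norm_num) (by norm_num) (by norm_num)
    (by norm_num) (by norm_num) (by norm_num) (by norm_num) (by norm_num) (by norm_num) (by norm_num) (by norm_num) (by norm_num) le_rfl
    (by norm_num) (by norm_num) (by norm_num) (by norm_num) (by norm_num) (by norm_num) hEN hOC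

/-- ★★ **(XR♮) AT THE RE-PINNED TUBE `dB = 1/10` FROM (SC) ∧ (EN) ∧ (OC) (PROVED instance)** — part YZ's junction at `d = 2/5 = dm − dB`, `σ = 17/20`:
(SC) is asked at separation `17/20` (was `3/4`; STRONGER by the floor only), the record tube becomes `(Rg, sb, dI, dB) = (5, 3/400, 3/400, 1/10)`, all other
dials of 74D unchanged. [this file, g75] -/
theorem shadowReferenceP_instance_of_enclosure {ϑc : ℝ}
    (hSC : CoolZoneShadowCrystalP ϑc (1 / 10) 8 4 12 16 (17 / 20) (1 / 10000) 5 (1 / 10000) 10 (43 / 2) 1 2 (1 / 16) (1 / 50))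
    (hEN : EnclosureNetP ϑc (1 / 10) 8 4 12 16 (17 / 20) (1 / 10000) 5 (1 / 10000) 10 (43 / 2) (1 / 1000) (1 / 100) (4 / 5) (1 / 2) 2
      1 2 (1 / 16) (1 / 50))
    (hOC : CoreOccupancyP ϑc (1 / 10) 8 4 12 16 (17 / 20) (1 / 10000) 5 (1 / 10000) 10 (43 / 2) (2 / 5) 1 2 (1 / 16) (1 / 50)) :
    ShadowReferenceP ϑc (1 / 100) (1 / 10) 8 4 12 16 16 (1 / 2) (1 / 5000) 5 (3 / 400) (3 / 400) (1 / 10) (17 / 20) (1 / 10000) (1 / 10000)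
      (19 / 4) (21 / 4) 1 2 (1 / 16) (1 / 50) :=
  shadowReferenceP_of_coolShell_mildCore le_rfl (by norm_num) (by norm_num) (by norm_num) (by norm_num) (by norm_num)
    (by rw [max_self]; norm_num) (by norm_num) (by norm_num) (by norm_num) (by norm_num) (by norm_num) (by norm_num) (by norm_num) (by norm_num)
    (by norm_num) (by norm_num) (by norm_num) (by norm_num) (by norm_num) hSC (mildCoreFillingP_instance_of_enclosure hEN hOC)

/-- ★★ **THE RE-PINNED DOCKET SLOT (PROVED)**: (SC) ∧ (EN) ∧ (OC) ∧ (X1)@`dB = 1/10` ∧ (X2ᴸ♮)@`dB = 1/10` (inner tube `(1/200, 1/200, 1/20)`) give the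
existence leaf `CoolMoatSlavedFillingP ϑc (1/100) (1/10) 8 4 12 16 16 (1/2) 1 2 (1/16) (1/50)` (column `_16XH28BVT`, `∃ ϑm`), by part YY's slot;
modulus `lam > 0` free.  The price of the re-pin is visible here: `dB₁ = 1/20 < dB = 1/10` (was `3/20 < 3/10`). [this file, g75] -/
theorem coolMoatSlavedFillingP_tubeSlot_of_enclosure {ϑc lam : ℝ} (hlam : 0 < lam)
    (hSC : CoolZoneShadowCrystalP ϑc (1 / 10) 8 4 12 16 (17 / 20) (1 / 10000) 5 (1 / 10000) 10 (43 / 2) 1 2 (1 / 16) (1 / 50))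
    (hEN : EnclosureNetP ϑc (1 / 10) 8 4 12 16 (17 / 20) (1 / 10000) 5 (1 / 10000) 10 (43 / 2) (1 / 1000) (1 / 100) (4 / 5) (1 / 2) 2
      1 2 (1 / 16) (1 / 50))
    (hOC : CoreOccupancyP ϑc (1 / 10) 8 4 12 16 (17 / 20) (1 / 10000) 5 (1 / 10000) 10 (43 / 2) (2 / 5) 1 2 (1 / 16) (1 / 50))
    (hX1 : TubeConvexityP ϑc (1 / 100) (1 / 10) 8 4 12 16 16 (1 / 2) (1 / 5000) 5 (3 / 400) (3 / 400) (1 / 10) lam 1 2 (1 / 16) (1 / 50))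
    (hX2 : ShadowLoadedTubeAprioriP ϑc (1 / 100) (1 / 10) 8 4 12 16 16 (1 / 2) (1 / 5000) 5 (3 / 400) (3 / 400) (1 / 10) (17 / 20) (1 / 10000)
      (1 / 10000) (19 / 4) (21 / 4) (1 / 200) (1 / 200) (1 / 20) 1 2 (1 / 16) (1 / 50)) :
    CoolMoatSlavedFillingP ϑc (1 / 100) (1 / 10) 8 4 12 16 16 (1 / 2) 1 2 (1 / 16) (1 / 50) :=
  coolMoatSlavedFillingP_tubeSlot_of_shadowLoadPath hlam (by norm_num) (by norm_num) (by norm_num) (by norm_num) (by norm_num) (by norm_num)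
    (shadowReferenceP_instance_of_enclosure hSC hEN hOC) hX1 hX2

/-- ★ **THE RECORD PIN IS OUT OF REACH OF THE ENCLOSURE ARITHMETIC (PROVED arithmetic; the canary's positive twin)**: at `ϑp = 1/10`, `κ ≤ 1`,
`ε₁, ζ ≥ 0` the soft-datum condition `3ϑp + 2ε₁ + ζ ≤ κ·d` forces `d ≥ 3/10 > 1/5 = d_record` — consistent with the graded-slip adversary (drift
`≈ 1/5 + gap′/40` with all stars tame); the matching radius of 74D must be re-pinned (`dB = dm − d ≤ 1/5`; this part takes `dB = 1/10`). [this file, g75] -/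
theorem record_pin_infeasible {κ ε₁ ζ d : ℝ} (hκ₁ : κ ≤ 1) (hε₁ : 0 ≤ ε₁) (hζ : 0 ≤ ζ) (hd : 0 ≤ d)
    (hA : 3 * (1 / 10 : ℝ) + 2 * ε₁ + ζ ≤ κ * d) : 3 / 10 ≤ d := by
  nlinarith [mul_le_mul_of_nonneg_right hκ₁ hd]

end Junction

end Summit.AtomisticToContinuum.Crystallization.Theorems.ChartedZeroExcessLayeredLatticeLiouville

end
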